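import Mathlib
import Summits.Ventures.PercRepro2.PMK5Deg3Kernel
import Summits.Ventures.PercRepro2.Deg3Kron
import Summits.Ventures.PercRepro2.Deg3Tables
import Summits.Ventures.PercRepro2.Deg3Slices
import Summits.Ventures.PercRepro2.PMK5Deg5Kernel
import Summits.Ventures.PercRepro2.PMK5Deg5Kernel6
import Summits.Ventures.PercRepro2.Deg5Kron6
import Summits.Ventures.PercRepro2.Deg5Digits6
import Summits.Ventures.PercRepro2.Deg5Bits6

/-!
# The six-digit slice decomposition on fifteen edges: triple counts are sums of nine-edge counts of restricted tables
(blind cell PercRepro2, mine-2 g29; the bridge between the six-digit slice certificates of `PMK5Deg5Kernel6.lean`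
and the typed counts of `K₃` on `K₆`; mine-2 g28's `Deg4Slices5.lean` one sliced digit deeper)

* `ext6_eq`, `res6_eq`, **`cnt3n_fifteen`**: the generic restriction identity `Deg3.cnt3n_succ` applied six times
  (edges `14, 13, 12, 11, 10, 9`): the fifteen-edge count of a monomial is the nested list sum of nine-edge counts of
  `res6`-restricted tables — the slice counts `cntSlice`, `cntPosS`, `cntNegS`, and `cntPos15_eq`, `cntNeg15_eq`
  (`cntPos15`, `cntNeg15`: the positive and negative fifteen-edge counts of `K₃`);
* `kSlice_eq`, `kPosU_eq`, `kNegU_eq`, `kPosS_eq_kPosU`, `kNegS_eq_kNegU`: the slice numbers are the Kronecker sums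
  of the slice counts (twelve binders, `ring` at the leaf);
* `cntPosS_lt`, `cntNegS_lt`: the slice counts are below `KB = 2^28` (at most `10 · 3^6` counts `≤ 3^9`);
* **`cntNegS_le_cntPosS`**: a slice certificate gives `cntNegS ≤ cntPosS` at every nine-edge profile.
-/

namespace Summit.Ventures.PercRepro2

open Hub

namespace Deg5

namespace Six

/-! ## The six edges `9, …, 14` of the fifteen-edge graph -/

/-- `ext6` is `snoc` six times. -/
lemma ext6_eq (ω : Fin 9 → Bool) (a b c d e f : Bool) :
    ext6 ω a b c d e f = Fin.snoc (Fin.snoc (Fin.snoc (Fin.snoc (Fin.snoc (Fin.snoc ω a) b) c) d) e) f := by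
  funext g
  induction g using Fin.lastCases with
  | last => rw [Fin.snoc_last]; rfl
  | cast g =>
    induction g using Fin.lastCases with
    | last => rw [Fin.snoc_castSucc, Fin.snoc_last]; rfl
    | cast g =>
      induction g using Fin.lastCases with
      | last => rw [Fin.snoc_castSucc, Fin.snoc_castSucc, Fin.snoc_last]; rfl
      | cast g =>
        induction g using Fin.lastCases with
        | last => rw [Fin.snoc_castSucc, Fin.snoc_castSucc, Fin.snoc_castSucc, Fin.snoc_last]; rfl
        | cast g =>
          induction g using Fin.lastCases with
          | last =>
            rw [Fin.snoc_castSucc, Fin.snoc_castSucc, Fin.snoc_castSucc, Fin.snoc_castSucc, Fin.snoc_last]; rfl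
          | cast g =>
            induction g using Fin.lastCases with
            | last =>
              rw [Fin.snoc_castSucc, Fin.snoc_castSucc, Fin.snoc_castSucc, Fin.snoc_castSucc, Fin.snoc_castSucc,
                Fin.snoc_last]; rfl
            | cast g =>
              rw [Fin.snoc_castSucc, Fin.snoc_castSucc, Fin.snoc_castSucc, Fin.snoc_castSucc, Fin.snoc_castSucc,
                Fin.snoc_castSucc]
              simp [ext6]

/-- `res6` is the restriction of edge `14`, then `13`, `12`, `11`, `10`, `9`. -/
lemma res6_eq (T : (Fin 15 → Bool) → Bool) (a b c d e f : Bool) :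
    res6 T a b c d e f = Deg3.resL (Deg3.resL (Deg3.resL (Deg3.resL (Deg3.resL (Deg3.resL T f) e) d) c) b) a := by
  funext ω
  simp [res6, Deg3.resL, ext6_eq]

/-- **The six-step decomposition**: a fifteen-edge triple count is the nested list sum, over the splits of
the digits of edges `14, 13, 12, 11, 10, 9`, of nine-edge counts of the `res6`-restricted tables. -/
theorem cnt3n_fifteen (T₁ T₂ T₃ : (Fin 15 → Bool) → Bool) (k : Fin 15 → Fin 4) :
    Deg3.cnt3n T₁ T₂ T₃ k = ((Deg3.splits3 (k 14)).map fun s₆ => ((Deg3.splits3 (k 13)).map fun s₅ =>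
      ((Deg3.splits3 (k 12)).map fun s₄ => ((Deg3.splits3 (k 11)).map fun s₃ =>
        ((Deg3.splits3 (k 10)).map fun s₂ => ((Deg3.splits3 (k 9)).map fun s₁ =>
          cnt3 (res6 T₁ s₁.1 s₂.1 s₃.1 s₄.1 s₅.1 s₆.1) (res6 T₂ s₁.2.1 s₂.2.1 s₃.2.1 s₄.2.1 s₅.2.1 s₆.2.1)
            (res6 T₃ s₁.2.2 s₂.2.2 s₃.2.2 s₄.2.2 s₅.2.2 s₆.2.2)
            (fun i => k i.castSucc.castSucc.castSucc.castSucc.castSucc.castSucc)).sum).sum).sum).sum).sum).sum := by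
  rw [Deg3.cnt3n_succ]
  have h14 : k (Fin.last 14) = k 14 := rfl
  rw [h14]
  refine congrArg List.sum (List.map_congr_left fun s₆ _ => ?_)
  rw [Deg3.cnt3n_succ]
  have h13 : k (Fin.last 13).castSucc = k 13 := rfl
  rw [h13]
  refine congrArg List.sum (List.map_congr_left fun s₅ _ => ?_)
  rw [Deg3.cnt3n_succ]
  have h12 : k (Fin.last 12).castSucc.castSucc = k 12 := rfl
  rw [h12]
  refine congrArg List.sum (List.map_congr_left fun s₄ _ => ?_)
  rw [Deg3.cnt3n_succ]
  have h11 : k (Fin.last 11).castSucc.castSucc.castSucc = k 11 := rfl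
  rw [h11]
  refine congrArg List.sum (List.map_congr_left fun s₃ _ => ?_)
  rw [Deg3.cnt3n_succ]
  have h10 : k (Fin.last 10).castSucc.castSucc.castSucc.castSucc = k 10 := rfl
  rw [h10]
  refine congrArg List.sum (List.map_congr_left fun s₂ _ => ?_)
  rw [Deg3.cnt3n_succ]
  have h9 : k (Fin.last 9).castSucc.castSucc.castSucc.castSucc.castSucc = k 9 := rfl
  rw [h9]
  refine congrArg List.sum (List.map_congr_left fun s₁ _ => ?_)
  rw [res6_eq, res6_eq, res6_eq]
  rfl

/-! ## The monomials and the slice counts -/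

/-- The slice count of a monomial at the nine-edge profile `k` (digits `j₁, …, j₆` on the edges `9, …, 14`). -/
def cntSlice (M : Fin 19 × Fin 19 × Fin 19) (j₁ j₂ j₃ j₄ j₅ j₆ : ℕ) (k : Fin 9 → Fin 4) : ℕ :=
  ((Deg3.splits3 j₆).map fun s₆ => ((Deg3.splits3 j₅).map fun s₅ => ((Deg3.splits3 j₄).map fun s₄ =>
    ((Deg3.splits3 j₃).map fun s₃ => ((Deg3.splits3 j₂).map fun s₂ => ((Deg3.splits3 j₁).map fun s₁ =>
      cnt3 (res6 (tab M.1) s₁.1 s₂.1 s₃.1 s₄.1 s₅.1 s₆.1)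
        (res6 (tab M.2.1) s₁.2.1 s₂.2.1 s₃.2.1 s₄.2.1 s₅.2.1 s₆.2.1)
        (res6 (tab M.2.2) s₁.2.2 s₂.2.2 s₃.2.2 s₄.2.2 s₅.2.2 s₆.2.2) k).sum).sum).sum).sum).sum).sum

/-- The ungrouped slice number of a monomial, from the literals. -/
def kSlice (L : Fin 19 → Bool → Bool → Bool → Bool → Bool → Bool → ℕ) (M : Fin 19 × Fin 19 × Fin 19)
    (j₁ j₂ j₃ j₄ j₅ j₆ : ℕ) : ℕ :=
  ((Deg3.splits3 j₆).map fun s₆ => ((Deg3.splits3 j₅).map fun s₅ => ((Deg3.splits3 j₄).map fun s₄ =>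
    ((Deg3.splits3 j₃).map fun s₃ => ((Deg3.splits3 j₂).map fun s₂ => ((Deg3.splits3 j₁).map fun s₁ =>
      KL L M.1 s₁.1 s₂.1 s₃.1 s₄.1 s₅.1 s₆.1 * KL L M.2.1 s₁.2.1 s₂.2.1 s₃.2.1 s₄.2.1 s₅.2.1 s₆.2.1 *
        KL L M.2.2 s₁.2.2 s₂.2.2 s₃.2.2 s₄.2.2 s₅.2.2 s₆.2.2).sum).sum).sum).sum).sum).sum

/-- The positive slice counts. -/
def cntPosS (j₁ j₂ j₃ j₄ j₅ j₆ : ℕ) (k : Fin 9 → Fin 4) : ℕ :=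
  (Deg3.posMonos.map fun M => cntSlice M j₁ j₂ j₃ j₄ j₅ j₆ k).sum

/-- The negative slice counts. -/
def cntNegS (j₁ j₂ j₃ j₄ j₅ j₆ : ℕ) (k : Fin 9 → Fin 4) : ℕ :=
  (Deg3.negMonos.map fun M => cntSlice M j₁ j₂ j₃ j₄ j₅ j₆ k).sum

/-- The ungrouped positive slice number. -/
def kPosU (L : Fin 19 → Bool → Bool → Bool → Bool → Bool → Bool → ℕ) (j₁ j₂ j₃ j₄ j₅ j₆ : ℕ) : ℕ :=
  (Deg3.posMonos.map fun M => kSlice L M j₁ j₂ j₃ j₄ j₅ j₆).sum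

/-- The ungrouped negative slice number. -/
def kNegU (L : Fin 19 → Bool → Bool → Bool → Bool → Bool → Bool → ℕ) (j₁ j₂ j₃ j₄ j₅ j₆ : ℕ) : ℕ :=
  (Deg3.negMonos.map fun M => kSlice L M j₁ j₂ j₃ j₄ j₅ j₆).sum

/-- The positive fifteen-edge counts of `K₃` (the ten positive monomials `Deg3.posMonos`, tables by index). -/
def cntPos15 (k : Fin 15 → Fin 4) : ℕ :=
  (Deg3.posMonos.map fun M => Deg3.cnt3n (tab M.1) (tab M.2.1) (tab M.2.2) k).sum

/-- The negative fifteen-edge counts of `K₃` (the ten negative monomials `Deg3.negMonos`). -/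
def cntNeg15 (k : Fin 15 → Fin 4) : ℕ :=
  (Deg3.negMonos.map fun M => Deg3.cnt3n (tab M.1) (tab M.2.1) (tab M.2.2) k).sum

/-- The nine-edge part of a fifteen-edge profile. -/
def restr (k : Fin 15 → Fin 4) : Fin 9 → Fin 4 := fun i => k i.castSucc.castSucc.castSucc.castSucc.castSucc.castSucc

/-- The positive fifteen-edge counts are the six-digit slice counts at the profile's six last digits. -/
lemma cntPos15_eq (k : Fin 15 → Fin 4) :
    cntPos15 k = cntPosS (k 9) (k 10) (k 11) (k 12) (k 13) (k 14) (restr k) := by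
  unfold cntPos15 cntPosS cntSlice restr
  simp only [cnt3n_fifteen]

/-- The negative fifteen-edge counts are the six-digit slice counts at the profile's six last digits. -/
lemma cntNeg15_eq (k : Fin 15 → Fin 4) :
    cntNeg15 k = cntNegS (k 9) (k 10) (k 11) (k 12) (k 13) (k 14) (restr k) := by
  unfold cntNeg15 cntNegS cntSlice restr
  simp only [cnt3n_fifteen]

/-! ## The slice numbers are the Kronecker sums of the slice counts -/

/-- The ungrouped slice number of a monomial is the Kronecker sum of its slice counts (correct literals). -/
lemma kSlice_eq {L : Fin 19 → Bool → Bool → Bool → Bool → Bool → Bool → ℕ} (hL : LitOK L)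
    (M : Fin 19 × Fin 19 × Fin 19) (j₁ j₂ j₃ j₄ j₅ j₆ : ℕ) :
    kSlice L M j₁ j₂ j₃ j₄ j₅ j₆ = ∑ k, cntSlice M j₁ j₂ j₃ j₄ j₅ j₆ k * KB ^ idx4 k := by
  unfold kSlice cntSlice
  simp only [KL_eq hL, kron_eq_kronSum, kronSum_mul_mul, Deg3.listSum_finsetSum,
    List.sum_map_mul_right]

/-- The ungrouped positive slice number is the Kronecker sum of the positive slice counts. -/
lemma kPosU_eq {L : Fin 19 → Bool → Bool → Bool → Bool → Bool → Bool → ℕ} (hL : LitOK L)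
    (j₁ j₂ j₃ j₄ j₅ j₆ : ℕ) :
    kPosU L j₁ j₂ j₃ j₄ j₅ j₆ = ∑ k, cntPosS j₁ j₂ j₃ j₄ j₅ j₆ k * KB ^ idx4 k := by
  unfold kPosU cntPosS
  simp only [kSlice_eq hL, Deg3.listSum_finsetSum, List.sum_map_mul_right]

/-- The ungrouped negative slice number is the Kronecker sum of the negative slice counts. -/
lemma kNegU_eq {L : Fin 19 → Bool → Bool → Bool → Bool → Bool → Bool → ℕ} (hL : LitOK L)
    (j₁ j₂ j₃ j₄ j₅ j₆ : ℕ) :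
    kNegU L j₁ j₂ j₃ j₄ j₅ j₆ = ∑ k, cntNegS j₁ j₂ j₃ j₄ j₅ j₆ k * KB ^ idx4 k := by
  unfold kNegU cntNegS
  simp only [kSlice_eq hL, Deg3.listSum_finsetSum, List.sum_map_mul_right]

/-- **The grouped positive slice number of the kernel file is the ungrouped one** (uniform in the slice). -/
lemma kPosS_eq_kPosU (L : Fin 19 → Bool → Bool → Bool → Bool → Bool → Bool → ℕ) (j₁ j₂ j₃ j₄ j₅ j₆ : ℕ) :
    kPosS L j₁ j₂ j₃ j₄ j₅ j₆ = kPosU L j₁ j₂ j₃ j₄ j₅ j₆ := by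
  unfold kPosU kSlice
  simp only [Deg3.splits3_eq_pairs]
  rw [Deg3.listSum_map_sum_comm Deg3.posMonos Deg3.bools]
  simp only [Deg3.listSum_map_sum_comm Deg3.posMonos (Deg3.pairs2 _ _),
    Deg3.listSum_map_sum_comm Deg3.posMonos Deg3.bools]
  simp only [Deg3.listSum_map_sum_comm (Deg3.pairs2 _ _) Deg3.bools]
  simp only [Deg3.posMonos, List.map_cons, List.map_nil, List.sum_cons, List.sum_nil, add_zero]
  unfold kPosS inner
  simp only [← List.sum_map_mul_left, ← List.sum_map_add]
  refine congrArg List.sum (List.map_congr_left fun a₆ _ => congrArg List.sum (List.map_congr_left fun a₅ _ =>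
    congrArg List.sum (List.map_congr_left fun a₄ _ => congrArg List.sum (List.map_congr_left fun a₃ _ =>
      congrArg List.sum (List.map_congr_left fun a₂ _ => congrArg List.sum (List.map_congr_left fun a₁ _ =>
        congrArg List.sum (List.map_congr_left fun p₆ _ => congrArg List.sum (List.map_congr_left fun p₅ _ =>
          congrArg List.sum (List.map_congr_left fun p₄ _ => congrArg List.sum (List.map_congr_left fun p₃ _ =>
            congrArg List.sum (List.map_congr_left fun p₂ _ =>
              congrArg List.sum (List.map_congr_left fun p₁ _ => ?_))))))))))))
  simp only [brPosPD, brPosPDoU, brPosQ, S1, S2, S3]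
  ring

/-- **The grouped negative slice number of the kernel file is the ungrouped one.** -/
lemma kNegS_eq_kNegU (L : Fin 19 → Bool → Bool → Bool → Bool → Bool → Bool → ℕ) (j₁ j₂ j₃ j₄ j₅ j₆ : ℕ) :
    kNegS L j₁ j₂ j₃ j₄ j₅ j₆ = kNegU L j₁ j₂ j₃ j₄ j₅ j₆ := by
  unfold kNegU kSlice
  simp only [Deg3.splits3_eq_pairs]
  rw [Deg3.listSum_map_sum_comm Deg3.negMonos Deg3.bools]
  simp only [Deg3.listSum_map_sum_comm Deg3.negMonos (Deg3.pairs2 _ _),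
    Deg3.listSum_map_sum_comm Deg3.negMonos Deg3.bools]
  simp only [Deg3.listSum_map_sum_comm (Deg3.pairs2 _ _) Deg3.bools]
  simp only [Deg3.negMonos, List.map_cons, List.map_nil, List.sum_cons, List.sum_nil, add_zero]
  unfold kNegS inner
  simp only [← List.sum_map_mul_left, ← List.sum_map_add]
  refine congrArg List.sum (List.map_congr_left fun a₆ _ => congrArg List.sum (List.map_congr_left fun a₅ _ =>
    congrArg List.sum (List.map_congr_left fun a₄ _ => congrArg List.sum (List.map_congr_left fun a₃ _ =>
      congrArg List.sum (List.map_congr_left fun a₂ _ => congrArg List.sum (List.map_congr_left fun a₁ _ =>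
        congrArg List.sum (List.map_congr_left fun p₆ _ => congrArg List.sum (List.map_congr_left fun p₅ _ =>
          congrArg List.sum (List.map_congr_left fun p₄ _ => congrArg List.sum (List.map_congr_left fun p₃ _ =>
            congrArg List.sum (List.map_congr_left fun p₂ _ =>
              congrArg List.sum (List.map_congr_left fun p₁ _ => ?_))))))))))))
  simp only [brNegPD, brNegPDoU, brNegQ, S1', S2', S3']
  ring

/-! ## The slice counts are below `KB` -/

/-- A slice count of a monomial is at most `3^6 · 3^9 = 3^15`. -/
lemma cntSlice_le (M : Fin 19 × Fin 19 × Fin 19) (j₁ j₂ j₃ j₄ j₅ j₆ : ℕ) (k : Fin 9 → Fin 4) :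
    cntSlice M j₁ j₂ j₃ j₄ j₅ j₆ k ≤ 729 * 19683 := by
  unfold cntSlice
  refine (Deg3.sum_map_le _ _ (243 * 19683) fun s₆ _ => ?_).trans ?_
  · refine (Deg3.sum_map_le _ _ (81 * 19683) fun s₅ _ => ?_).trans ?_
    · refine (Deg3.sum_map_le _ _ (27 * 19683) fun s₄ _ => ?_).trans ?_
      · refine (Deg3.sum_map_le _ _ (9 * 19683) fun s₃ _ => ?_).trans ?_
        · refine (Deg3.sum_map_le _ _ (3 * 19683) fun s₂ _ => ?_).trans ?_
          · refine (Deg3.sum_map_le _ _ 19683 fun s₁ _ => cnt3_le _ _ _ _).trans ?_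
            exact Nat.mul_le_mul_right _ (Deg3.splits3_length_le j₁)
          · calc (Deg3.splits3 j₂).length * (3 * 19683) ≤ 3 * (3 * 19683) :=
                  Nat.mul_le_mul_right _ (Deg3.splits3_length_le j₂)
              _ = 9 * 19683 := by norm_num
        · calc (Deg3.splits3 j₃).length * (9 * 19683) ≤ 3 * (9 * 19683) :=
                Nat.mul_le_mul_right _ (Deg3.splits3_length_le j₃)
            _ = 27 * 19683 := by norm_num
      · calc (Deg3.splits3 j₄).length * (27 * 19683) ≤ 3 * (27 * 19683) :=
              Nat.mul_le_mul_right _ (Deg3.splits3_length_le j₄)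
          _ = 81 * 19683 := by norm_num
    · calc (Deg3.splits3 j₅).length * (81 * 19683) ≤ 3 * (81 * 19683) :=
            Nat.mul_le_mul_right _ (Deg3.splits3_length_le j₅)
        _ = 243 * 19683 := by norm_num
  · calc (Deg3.splits3 j₆).length * (243 * 19683) ≤ 3 * (243 * 19683) :=
          Nat.mul_le_mul_right _ (Deg3.splits3_length_le j₆)
      _ = 729 * 19683 := by norm_num

/-- `KB = 268435456`. -/
lemma KB_val : KB = 268435456 := by rw [KB_eq]; norm_num

/-- The positive slice counts are below `KB = 2^28` (ten monomials, `10 · 3^15 = 143489070`). -/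
lemma cntPosS_lt (j₁ j₂ j₃ j₄ j₅ j₆ : ℕ) (k : Fin 9 → Fin 4) :
    cntPosS j₁ j₂ j₃ j₄ j₅ j₆ k < KB := by
  unfold cntPosS
  have h := Deg3.sum_map_le Deg3.posMonos (fun M => cntSlice M j₁ j₂ j₃ j₄ j₅ j₆ k) (729 * 19683)
    fun M _ => cntSlice_le M j₁ j₂ j₃ j₄ j₅ j₆ k
  have hl : Deg3.posMonos.length = 10 := rfl
  rw [hl] at h
  rw [KB_val]
  omega

/-- The negative slice counts are below `KB`. -/
lemma cntNegS_lt (j₁ j₂ j₃ j₄ j₅ j₆ : ℕ) (k : Fin 9 → Fin 4) :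
    cntNegS j₁ j₂ j₃ j₄ j₅ j₆ k < KB := by
  unfold cntNegS
  have h := Deg3.sum_map_le Deg3.negMonos (fun M => cntSlice M j₁ j₂ j₃ j₄ j₅ j₆ k) (729 * 19683)
    fun M _ => cntSlice_le M j₁ j₂ j₃ j₄ j₅ j₆ k
  have hl : Deg3.negMonos.length = 10 := rfl
  rw [hl] at h
  rw [KB_val]
  omega

/-! ## The slice certificate read digit by digit -/

/-- **A six-digit slice certificate bounds the negative slice counts by the positive ones** at every nine-edge
profile. -/
theorem cntNegS_le_cntPosS {L : Fin 19 → Bool → Bool → Bool → Bool → Bool → Bool → ℕ}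
    (hL : LitOK L) {j₁ j₂ j₃ j₄ j₅ j₆ : ℕ} (hc : CertS L j₁ j₂ j₃ j₄ j₅ j₆) (k : Fin 9 → Fin 4) :
    cntNegS j₁ j₂ j₃ j₄ j₅ j₆ k ≤ cntPosS j₁ j₂ j₃ j₄ j₅ j₆ k :=
  le_of_kron_le' (cntPosS j₁ j₂ j₃ j₄ j₅ j₆) (cntNegS j₁ j₂ j₃ j₄ j₅ j₆)
    (cntPosS_lt j₁ j₂ j₃ j₄ j₅ j₆) (cntNegS_lt j₁ j₂ j₃ j₄ j₅ j₆)
    ((kPosS_eq_kPosU L j₁ j₂ j₃ j₄ j₅ j₆).trans (kPosU_eq hL j₁ j₂ j₃ j₄ j₅ j₆))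
    ((kNegS_eq_kNegU L j₁ j₂ j₃ j₄ j₅ j₆).trans (kNegU_eq hL j₁ j₂ j₃ j₄ j₅ j₆)) hc.1 hc.2.1 hc.2.2 k

end Six

end Deg5

end Summit.Ventures.PercRepro2
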